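import Summits.Ventures.QEC.CircuitDistance.PortSectorFinal
import HarnessLib

/-!
# `X ↔ Z` TRANSPORT of the K2 completeness binder (Q4 lane; cell CDX — director-qec R154 (3)(ii)(f); drafted by qec-cdx-idea-1 g4,
# typed by qec-cdx-type-2, statement audit qec-cdx-crit-1 2026-08-29T00:45:55Z)

For an abelian two-block (BB) code the qubit involution `colSwap : L g ↦ R (−g), R g ↦ L (−g)` (tree:
`AbelianTwoBlock.colSwap`, with `zLogical_iff_xLogical_comp_colSwap`) exchanges `Z`-nontrivial and `X`-nontrivial residuals.
If the one-cycle CLASS TABLES of a schedule are `colSwap`-dual (`ClassDual`, a finite `decide`-sized table fact) and the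
`Z` leaf WORDS are the duals of the `X` leaf words (`WordsDual`, finite), then the `Z`-sector K2 completeness binder follows
from the `X`-sector one (`k2Z_of_k2X`).  Nothing here is specific to `[[144,12,12]]` or to order #345; nothing here asserts a
value of `d_circ`.
-/

namespace Summit.Ventures.QEC.CircuitDistance.Transport

open Literature.InformationTheory.QuantumCodes
open Summit.Ventures.QEC.CircuitDistance

variable {ℓ m : ℕ} [NeZero ℓ] [NeZero m]

/-- `(l.map f).toFinset = l.toFinset.image f` (private: the same list lemma exists under other names elsewhere in the tree). -/
private theorem toFinset_map_eq_image {α β : Type*} [DecidableEq α] [DecidableEq β] (f : α → β) (l : List α) :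
    (l.map f).toFinset = l.toFinset.image f := by
  ext b; simp

/-- The dual of a set of qubits under `colSwap`. -/
def dualQ (s : Finset (BB.Mono ℓ m ⊕ BB.Mono ℓ m)) : Finset (BB.Mono ℓ m ⊕ BB.Mono ℓ m) :=
  s.map (AbelianTwoBlock.colSwap (BB.Mono ℓ m)).toEmbedding

/-- Membership in the dual set. -/
theorem mem_dualQ (s : Finset (BB.Mono ℓ m ⊕ BB.Mono ℓ m)) (q : BB.Mono ℓ m ⊕ BB.Mono ℓ m) :
    q ∈ dualQ s ↔ AbelianTwoBlock.colSwap (BB.Mono ℓ m) q ∈ s := by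
  unfold dualQ
  rw [Finset.mem_map_equiv, AbelianTwoBlock.colSwap_symm]

/-- `dualQ` is an involution. -/
theorem dualQ_dualQ (s : Finset (BB.Mono ℓ m ⊕ BB.Mono ℓ m)) : dualQ (dualQ s) = s := by
  ext q; rw [mem_dualQ, mem_dualQ, AbelianTwoBlock.colSwap_colSwap]

/-- `dualQ` is injective. -/
theorem dualQ_injective : Function.Injective (dualQ (ℓ := ℓ) (m := m)) := fun a b h => by
  rw [← dualQ_dualQ a, h, dualQ_dualQ]

/-- `indic (dualQ s) = indic s ∘ colSwap`. -/
theorem indic_dualQ (s : Finset (BB.Mono ℓ m ⊕ BB.Mono ℓ m)) :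
    indic (dualQ s) = indic s ∘ AbelianTwoBlock.colSwap (BB.Mono ℓ m) := by
  funext q; simp [indic, mem_dualQ]

/-- `colSwap` conjugates translation by `t` to translation by `−t`. -/
theorem dualQ_trQ (t : BB.Mono ℓ m) (s : Finset (BB.Mono ℓ m ⊕ BB.Mono ℓ m)) :
    dualQ (trQ t s) = trQ (-t) (dualQ s) := by
  ext q
  rw [mem_dualQ, mem_trQ, mem_trQ, mem_dualQ]
  rcases q with i | i
  · simp only [AbelianTwoBlock.colSwap_inl, translate_symm_inr, translate_symm_inl, AbelianTwoBlock.colSwap_inl,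
      neg_add_rev, neg_neg, add_comm]
  · simp only [AbelianTwoBlock.colSwap_inr, translate_symm_inl, translate_symm_inr, AbelianTwoBlock.colSwap_inr,
      neg_add_rev, neg_neg, add_comm]

/-- CODE LEVEL (tree, `AbelianTwoBlock.zLogical_iff_xLogical_comp_colSwap`): `Z`-nontrivial `v` iff `X`-nontrivial `v ∘ colSwap`. -/
theorem zNontrivial_iff_xNontrivial_comp (S : SMCode ℓ m) (v : BB.Mono ℓ m ⊕ BB.Mono ℓ m → ZMod 2) :
    ZNontrivial S v ↔ XNontrivial S (v ∘ AbelianTwoBlock.colSwap (BB.Mono ℓ m)) :=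
  AbelianTwoBlock.zLogical_iff_xLogical_comp_colSwap _ _ v

/-- TABLE LEVEL (finite; `decide`): every `Z`-class of `TZ` is, dualised, a translate of an `X`-class of `TX`. -/
def ClassDual (TX : XTable ℓ m) (TZ : ZTable ℓ m) : Prop :=
  ∀ k ∈ ZKind.all, ∀ c, TZ.cls k = some c → ∃ k' ∈ XKind.all, ∃ t : BB.Mono ℓ m, (TX.cls k').map (trQ t) = some (dualQ c)

/-- LEAF-LIST LEVEL (finite): every `X` leaf word, dualised, is a translate of some `Z` leaf word (as a set of classes). -/
def WordsDual (LX LZ : List (LeafEntry ℓ m)) : Prop :=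
  ∀ e ∈ LX, ∃ e' ∈ LZ, ∃ s : BB.Mono ℓ m, (e'.word.map (trQ s)).toFinset = (e.word.map dualQ).toFinset

/-- The `X`-sector K2 COMPLETENESS binder, generic in code / table / weight / leaves (cf. `K2_BB144_X`). -/
def K2X (S : SMCode ℓ m) (TX : XTable ℓ m) (w : ℕ) (LX : List (LeafEntry ℓ m)) : Prop :=
  ∀ x : Finset (Finset (BB.Mono ℓ m ⊕ BB.Mono ℓ m)), (∀ g ∈ x, IsXClass TX g) →
    XNontrivial S (∑ g ∈ x, indic g) → x.card ≤ w → ∃ e ∈ LX, ∃ t : BB.Mono ℓ m, x = (e.word.map (trQ t)).toFinset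

/-- The `Z`-sector K2 COMPLETENESS binder (cf. `K2_BB144_Z`). -/
def K2Z (S : SMCode ℓ m) (TZ : ZTable ℓ m) (w : ℕ) (LZ : List (LeafEntry ℓ m)) : Prop :=
  ∀ x : Finset (Finset (BB.Mono ℓ m ⊕ BB.Mono ℓ m)), (∀ g ∈ x, IsZClass TZ g) →
    ZNontrivial S (∑ g ∈ x, indic g) → x.card ≤ w → ∃ e ∈ LZ, ∃ t : BB.Mono ℓ m, x = (e.word.map (trQ t)).toFinset

/-- A dualised `Z`-class is an `X`-class. -/
theorem isXClass_dualQ {TX : XTable ℓ m} {TZ : ZTable ℓ m} (h : ClassDual TX TZ)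
    {g : Finset (BB.Mono ℓ m ⊕ BB.Mono ℓ m)} (hg : IsZClass TZ g) : IsXClass TX (dualQ g) := by
  rcases hg with ⟨k, hk, i, hi⟩
  rcases hc : TZ.cls k with _ | c
  · rw [hc] at hi; simp at hi
  · rw [hc, Option.map_some] at hi
    have hgi : g = trQ i c := (Option.some.inj hi).symm
    rcases h k hk c hc with ⟨k', hk', t, ht⟩
    refine ⟨k', hk', t + -i, ?_⟩
    rw [hgi, dualQ_trQ, show trQ (t + -i) = trQ (-i) ∘ trQ t from funext (trQ_add t (-i)), ← Option.map_map, ht,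
      Option.map_some]

/-- Sums of indicators commute with `colSwap`. -/
theorem sum_indic_dualQ (x : Finset (Finset (BB.Mono ℓ m ⊕ BB.Mono ℓ m))) :
    ∑ g ∈ x.image dualQ, indic g = (∑ g ∈ x, indic g) ∘ AbelianTwoBlock.colSwap (BB.Mono ℓ m) := by
  rw [Finset.sum_image (fun a _ b _ hab => dualQ_injective hab)]
  funext q
  simp only [Finset.sum_apply, Function.comp_apply, indic_dualQ]

/-- **TRANSPORT.** If the class tables are dual and the `Z` leaf words are the duals of the `X` leaf words, the `Z`-sector
K2 completeness binder follows from the `X`-sector one (same code, same weight). -/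
theorem k2Z_of_k2X (S : SMCode ℓ m) {TX : XTable ℓ m} {TZ : ZTable ℓ m} {w : ℕ} {LX LZ : List (LeafEntry ℓ m)}
    (hT : ClassDual TX TZ) (hL : WordsDual LX LZ) (hK : K2X S TX w LX) : K2Z S TZ w LZ := by
  classical
  intro x hcls hnt hcard
  -- pull back along the involution
  have h1 : ∀ g ∈ x.image dualQ, IsXClass TX g := by
    intro g hg
    rcases Finset.mem_image.1 hg with ⟨g₀, hg₀, rfl⟩
    exact isXClass_dualQ hT (hcls g₀ hg₀)
  have h2 : XNontrivial S (∑ g ∈ x.image dualQ, indic g) := by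
    rw [sum_indic_dualQ]; exact (zNontrivial_iff_xNontrivial_comp S _).1 hnt
  have h3 : (x.image dualQ).card ≤ w := by
    rw [Finset.card_image_of_injective _ dualQ_injective]; exact hcard
  rcases hK _ h1 h2 h3 with ⟨e, he, t, hxt⟩
  rcases hL e he with ⟨e', he', s, hs⟩
  refine ⟨e', he', s + -t, ?_⟩
  -- x = dual (dual x) = dual of a translate of e.word = translate of (dual e.word) = translate of a translate of e'.word
  have hx : x = (x.image dualQ).image dualQ := by
    rw [Finset.image_image]
    have : dualQ ∘ dualQ = (id : Finset (BB.Mono ℓ m ⊕ BB.Mono ℓ m) → _) := funext dualQ_dualQ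
    rw [this, Finset.image_id]
  rw [hx, hxt, ← toFinset_map_eq_image, List.map_map]
  have e1 : dualQ ∘ trQ t = trQ (-t) ∘ dualQ := funext (dualQ_trQ t)
  rw [e1, ← List.map_map, toFinset_map_eq_image, ← hs, ← toFinset_map_eq_image, List.map_map]
  have e2 : trQ (-t) ∘ trQ s = trQ (s + -t) := funext fun g => (trQ_add s (-t) g).symm
  rw [e2]

/-- Boolean form of `ClassDual` (what a `decide` runs: kinds × kinds × translations, table look-ups only). -/
def classDualB (TX : XTable ℓ m) (TZ : ZTable ℓ m) : Bool :=
  ZKind.all.all fun k => match TZ.cls k with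
    | none => true
    | some c => XKind.all.any fun k' => (monoList ℓ m).any fun t => decide ((TX.cls k').map (trQ t) = some (dualQ c))

/-- `classDualB = true` gives `ClassDual`. -/
theorem classDual_of_classDualB {TX : XTable ℓ m} {TZ : ZTable ℓ m} (h : classDualB TX TZ = true) : ClassDual TX TZ := by
  intro k hk c hc
  have hrow := (List.all_eq_true.1 h) k hk
  simp only [hc] at hrow
  rcases List.any_eq_true.1 hrow with ⟨k', hk', hany⟩
  rcases List.any_eq_true.1 hany with ⟨t, -, ht⟩
  exact ⟨k', hk', t, of_decide_eq_true ht⟩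

/-- Boolean form of `WordsDual` with the translation fixed to `0` and the same list order (the intended emission: the `Z` leaf
list is generated word-by-word as the dual of the `X` list). -/
def wordsDualB (LX LZ : List (LeafEntry ℓ m)) : Bool :=
  (LX.zip LZ).all (fun p => decide ((p.2.word.map (trQ (0 : BB.Mono ℓ m))).toFinset = (p.1.word.map dualQ).toFinset))
    && decide (LX.length = LZ.length)

/-- `wordsDualB = true` gives `WordsDual`. -/
theorem wordsDual_of_wordsDualB {LX LZ : List (LeafEntry ℓ m)} (h : wordsDualB LX LZ = true) : WordsDual LX LZ := by
  intro e he
  simp only [wordsDualB, Bool.and_eq_true, decide_eq_true_eq] at h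
  rcases h with ⟨hall, hlen⟩
  rcases List.mem_iff_getElem.1 he with ⟨i, hi, rfl⟩
  have hi' : i < LZ.length := hlen ▸ hi
  have hp : (LX[i], LZ[i]) ∈ LX.zip LZ := by
    rw [List.mem_iff_getElem]
    exact ⟨i, by simp [List.length_zip, hi, hi'], by simp [List.getElem_zip]⟩
  have := (List.all_eq_true.1 hall) _ hp
  exact ⟨LZ[i], List.getElem_mem hi', 0, of_decide_eq_true this⟩

end Summit.Ventures.QEC.CircuitDistance.Transport
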